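import Summits.ABC.StewartYu.KappaDoorSlot
import Summits.ABC.StewartYu.KappaDoorAlgebra
import Literature.NumberTheory.Transcendental.Waldschmidt1980HW2
import HarnessLib

/-!
# Cell abc-stewartyu, the κ-DOOR, IIc: the slots of an abc triple and the shared book-keeping

`Summits/ABC/StewartYu/KappaDoorPrelim.lean` — cell `abc-stewartyu` (HOME
`run/shared/lean/pub/abc-stewartyu/`, seat p3; HOME/plan/KAPPA-DOOR-RECIPE.md; theorems only).

For an abc triple `a + b = c` (`a ≤ b`, `c ≥ 3`) and the `p`-adic input `FinBoundAt p K L κ' σ τ τ₁`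
at the odd primes: the three `p`-adic slots `slot_c`, `slot_b`, `slot_a` (each available when its
member is ODD; `KappaDoorSlot.log_le_of_kappaSlot` with the congruences (10)–(12) of the printed
line [cite: StewartYu1991, (10)–(12)]), the archimedean slot `slot_arch` for `a² < b` (the tree's
`log_le_of_archRoute` with Waldschmidt 1980 PROVED, `waldschmidt1980_hW₂`), the Chebyshev absorptions
`absorb_top` / `absorb_none`, and the final real book-keeping `final_shape`. Everything is [folklore].
-/

noncomputable section

open Finset Real
open Literature.NumberTheory.DiophantineGeometry
open Literature.NumberTheory.DiophantineGeometry.Pasten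
open Literature.NumberTheory.Transcendental.Waldschmidt1980 (w80Cw w80Cw_nonneg w80Cw_le waldschmidt1980_hW₂)
open Literature.Barriers.ABC

namespace Summit.ABC.StewartYu

namespace KappaDoor

/-! ### Radical book-keeping -/

/-- A sub-product of the primes of `abc` is at most `rad(abc)`. [folklore] -/
theorem prod_le_rad_of_subset {a b c : ℕ} {U : Finset ℕ} (hU : U ⊆ (a * b * c).primeFactors) :
    ∏ q ∈ U, (q : ℝ) ≤ (rad a b c : ℝ) := by
  have hradS : rad a b c = ∏ q ∈ (a * b * c).primeFactors, q := by
    rw [rad_def, Nat.radical_eq_prod_primeFactors]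
  have hradpos : 0 < rad a b c := by rw [rad_def]; exact Nat.radical_pos _
  have h1 : ∏ q ∈ U, q ∣ ∏ q ∈ (a * b * c).primeFactors, q := Finset.prod_dvd_prod_of_subset _ _ _ hU
  have h2 : ∏ q ∈ U, q ≤ rad a b c := by rw [hradS]; exact Nat.le_of_dvd (hradS ▸ hradpos) h1
  have h3 := (Nat.cast_le (α := ℝ)).mpr h2
  rwa [Nat.cast_prod] at h3

/-- `rad(abc) ≥ 4` for an abc triple with `c ≥ 3` (`b ≥ 2` and `c` carry distinct primes). [folklore] -/
theorem four_le_rad {a b c : ℕ} (h : IsABCTriple a b c) (hab : a ≤ b) (hc3 : 3 ≤ c) :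
    (4 : ℝ) ≤ (rad a b c : ℝ) := by
  obtain ⟨ha, hb, habc, hcop⟩ := id h
  have hc0 : c ≠ 0 := by omega
  have ha0 : a ≠ 0 := ha.ne'
  have hb0 : b ≠ 0 := hb.ne'
  have hb2 : 2 ≤ b := by
    by_contra hlt
    have hb1 : b = 1 := by omega
    have ha1 : a = 1 := by omega
    omega
  have hbc : b.Coprime c := coprime_right_of_isABCTriple h
  obtain ⟨qb, hqb⟩ := Nat.nonempty_primeFactors.mpr hb2
  obtain ⟨qc, hqc⟩ := Nat.nonempty_primeFactors.mpr (show 2 ≤ c by omega)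
  have hne : qb ≠ qc := fun heq =>
    Finset.disjoint_left.mp hbc.disjoint_primeFactors hqb (heq ▸ hqc)
  have hS : (a * b * c).primeFactors = a.primeFactors ∪ b.primeFactors ∪ c.primeFactors := by
    rw [Nat.primeFactors_mul (mul_ne_zero ha0 hb0) hc0, Nat.primeFactors_mul ha0 hb0]
  have hsub : ({qb, qc} : Finset ℕ) ⊆ (a * b * c).primeFactors := by
    intro q hq
    rw [hS]
    rcases Finset.mem_insert.mp hq with rfl | hq
    · exact Finset.mem_union_left _ (Finset.mem_union_right _ hqb)
    · rw [Finset.mem_singleton] at hq; rw [hq]; exact Finset.mem_union_right _ hqc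
  have h1 := prod_le_rad_of_subset hsub
  rw [Finset.prod_pair hne] at h1
  have hqb2 : (2 : ℝ) ≤ qb := by exact_mod_cast (Nat.prime_of_mem_primeFactors hqb).two_le
  have hqc2 : (2 : ℝ) ≤ qc := by exact_mod_cast (Nat.prime_of_mem_primeFactors hqc).two_le
  nlinarith

/-! ### The slots of an abc triple -/

section Slots

variable {K L κ' σ : ℝ} {τ τ₁ : ℕ} {a b c : ℕ}

/-- **The slot at `c`** (`c` odd; generators the primes of `ab`; congruence (10) with `(a/b)²`). [folklore] -/
theorem slot_c (hK : 0 ≤ K) (hL : 1 ≤ L) (hσ0 : 0 ≤ σ)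
    (hP : ∀ p : ℕ, p.Prime → p ≠ 2 → FinBoundAt p K L κ' σ τ τ₁)
    (h : IsABCTriple a b c) (hab : a ≤ b) (hc3 : 3 ≤ c) (hodd : Odd c) :
    Real.log c ≤ (1 * K) * L ^ (a * b).primeFactors.card *
      ((((a * b).primeFactors.card : ℝ)) ^ (a * b).primeFactors.card) ^ κ' *
      (largestPrimeFactor c : ℝ) ^ σ * (∏ q ∈ (a * b).primeFactors, Real.log ((max 4 q : ℕ) : ℝ)) *
      (Real.log (6 * Real.log c) ^ τ * Real.log (rad a b c : ℝ) ^ τ₁ * Real.log (rad a b c : ℝ)) := by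
  obtain ⟨ha, hb, habc, hcop⟩ := id h
  have hc0 : c ≠ 0 := by omega
  have ha0 : a ≠ 0 := ha.ne'
  have hb0 : b ≠ 0 := hb.ne'
  have hneq : a ≠ b := by
    intro heq; rw [heq] at hcop
    have : b = 1 := by simpa using hcop
    omega
  have hac : a.Coprime c := coprime_left_of_isABCTriple h
  have hbc : b.Coprime c := coprime_right_of_isABCTriple h
  have hc3r : (3 : ℝ) ≤ c := by exact_mod_cast hc3
  have hlogc1 : 1 ≤ Real.log c := by
    rw [← Real.log_exp 1]; apply Real.log_le_log (Real.exp_pos 1); have := Real.exp_one_lt_d9; linarith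
  have hl1 : 0 ≤ Real.log (6 * Real.log c) := Real.log_nonneg (by linarith)
  have hl2 : 0 ≤ Real.log (rad a b c : ℝ) := Real.log_nonneg (by have := four_le_rad h hab hc3; linarith)
  have hsub : (a * b).primeFactors ⊆ (a * b * c).primeFactors := by
    rw [Nat.primeFactors_mul (mul_ne_zero ha0 hb0) hc0]; exact Finset.subset_union_left
  have hsubc : c.primeFactors ⊆ (a * b * c).primeFactors := by
    rw [Nat.primeFactors_mul (mul_ne_zero ha0 hb0) hc0]; exact Finset.subset_union_right
  have hprime : ∀ q ∈ (a * b).primeFactors, q.Prime := fun q hq => Nat.prime_of_mem_primeFactors hq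
  have heab : ∀ q ∈ (a * b).primeFactors, |(((2 * expDiff a b q : ℤ)) : ℝ)| ≤ 6 * Real.log c := by
    intro q hq
    have hq' := abs_expDiff_le ha0 hb0 hcop (show a ≤ c by omega) (show b ≤ c by omega) q
      (Nat.prime_of_mem_primeFactors hq)
    push_cast; rw [abs_mul, Nat.abs_ofNat]; linarith
  have key := log_le_of_kappaSlot hK (by linarith) hσ0 hP (four_le_rad h hab hc3) (by linarith)
    (fun q => 2 * expDiff a b q) hc0 hodd (Nat.Coprime.mul_right hac.symm hbc.symm)
    (prod_le_rad_of_subset hsub) (prod_le_rad_of_subset hsubc) heab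
    (prod_zpow_two_mul_expDiff_ne_one ha0 hb0 hcop hneq) (fun p hp => le_padicValRat_route_c h hneq hp)
  exact slot_reshape hK (by linarith) (Real.rpow_nonneg (by positivity) _) (prod_log_nonneg hprime)
    (prod_log_le_prod_log_max_four hprime) (by positivity) le_rfl le_rfl (by rw [one_mul]; exact key)

/-- **The slot at `b`** (`b` odd; generators the primes of `ca`; congruence (11)). [folklore] -/
theorem slot_b (hK : 0 ≤ K) (hL : 1 ≤ L) (hσ0 : 0 ≤ σ)
    (hP : ∀ p : ℕ, p.Prime → p ≠ 2 → FinBoundAt p K L κ' σ τ τ₁)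
    (h : IsABCTriple a b c) (hab : a ≤ b) (hc3 : 3 ≤ c) (hodd : Odd b) :
    Real.log b ≤ (1 * K) * L ^ (c * a).primeFactors.card *
      ((((c * a).primeFactors.card : ℝ)) ^ (c * a).primeFactors.card) ^ κ' *
      (largestPrimeFactor b : ℝ) ^ σ * (∏ q ∈ (c * a).primeFactors, Real.log ((max 4 q : ℕ) : ℝ)) *
      (Real.log (6 * Real.log c) ^ τ * Real.log (rad a b c : ℝ) ^ τ₁ * Real.log (rad a b c : ℝ)) := by
  obtain ⟨ha, hb, habc, hcop⟩ := id h
  have hc0 : c ≠ 0 := by omega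
  have ha0 : a ≠ 0 := ha.ne'
  have hb0 : b ≠ 0 := hb.ne'
  have hac : a.Coprime c := coprime_left_of_isABCTriple h
  have hbc : b.Coprime c := coprime_right_of_isABCTriple h
  have hc3r : (3 : ℝ) ≤ c := by exact_mod_cast hc3
  have hlogc1 : 1 ≤ Real.log c := by
    rw [← Real.log_exp 1]; apply Real.log_le_log (Real.exp_pos 1); have := Real.exp_one_lt_d9; linarith
  have hl1 : 0 ≤ Real.log (6 * Real.log c) := Real.log_nonneg (by linarith)
  have hl2 : 0 ≤ Real.log (rad a b c : ℝ) := Real.log_nonneg (by have := four_le_rad h hab hc3; linarith)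
  have hsub : (c * a).primeFactors ⊆ (a * b * c).primeFactors := by
    rw [Nat.primeFactors_mul hc0 ha0, Nat.primeFactors_mul (mul_ne_zero ha0 hb0) hc0,
      Nat.primeFactors_mul ha0 hb0]
    intro q hq
    rcases Finset.mem_union.mp hq with hq | hq
    · exact Finset.mem_union_right _ hq
    · exact Finset.mem_union_left _ (Finset.mem_union_left _ hq)
  have hsubb : b.primeFactors ⊆ (a * b * c).primeFactors := by
    rw [Nat.primeFactors_mul (mul_ne_zero ha0 hb0) hc0, Nat.primeFactors_mul ha0 hb0]
    exact (Finset.subset_union_right).trans Finset.subset_union_left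
  have hprime : ∀ q ∈ (c * a).primeFactors, q.Prime := fun q hq => Nat.prime_of_mem_primeFactors hq
  have heca : ∀ q ∈ (c * a).primeFactors, (|expDiff c a q| : ℝ) ≤ 6 * Real.log c := by
    intro q hq
    have := abs_expDiff_le hc0 ha0 hac.symm le_rfl (show a ≤ c by omega) q (Nat.prime_of_mem_primeFactors hq)
    linarith
  have key := log_le_of_kappaSlot hK (by linarith) hσ0 hP (four_le_rad h hab hc3) (by linarith)
    (expDiff c a) hb0 hodd (Nat.Coprime.mul_right hbc hcop.symm)
    (prod_le_rad_of_subset hsub) (prod_le_rad_of_subset hsubb) heca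
    (prod_zpow_expDiff_ne_one hc0 ha0 hac.symm (by omega))
    (fun p hp => by exact_mod_cast (padicValRat_route_b h hp).symm.le)
  exact slot_reshape hK (by linarith) (Real.rpow_nonneg (by positivity) _) (prod_log_nonneg hprime)
    (prod_log_le_prod_log_max_four hprime) (by positivity) le_rfl le_rfl (by rw [one_mul]; exact key)

/-- **The slot at `a`** (`a` odd; generators the primes of `cb`; congruence (12)). [folklore] -/
theorem slot_a (hK : 0 ≤ K) (hL : 1 ≤ L) (hσ0 : 0 ≤ σ)
    (hP : ∀ p : ℕ, p.Prime → p ≠ 2 → FinBoundAt p K L κ' σ τ τ₁)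
    (h : IsABCTriple a b c) (hab : a ≤ b) (hc3 : 3 ≤ c) (hodd : Odd a) :
    Real.log a ≤ (1 * K) * L ^ (c * b).primeFactors.card *
      ((((c * b).primeFactors.card : ℝ)) ^ (c * b).primeFactors.card) ^ κ' *
      (largestPrimeFactor a : ℝ) ^ σ * (∏ q ∈ (c * b).primeFactors, Real.log ((max 4 q : ℕ) : ℝ)) *
      (Real.log (6 * Real.log c) ^ τ * Real.log (rad a b c : ℝ) ^ τ₁ * Real.log (rad a b c : ℝ)) := by
  obtain ⟨ha, hb, habc, hcop⟩ := id h
  have hc0 : c ≠ 0 := by omega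
  have ha0 : a ≠ 0 := ha.ne'
  have hb0 : b ≠ 0 := hb.ne'
  have hac : a.Coprime c := coprime_left_of_isABCTriple h
  have hbc : b.Coprime c := coprime_right_of_isABCTriple h
  have hc3r : (3 : ℝ) ≤ c := by exact_mod_cast hc3
  have hlogc1 : 1 ≤ Real.log c := by
    rw [← Real.log_exp 1]; apply Real.log_le_log (Real.exp_pos 1); have := Real.exp_one_lt_d9; linarith
  have hl1 : 0 ≤ Real.log (6 * Real.log c) := Real.log_nonneg (by linarith)
  have hl2 : 0 ≤ Real.log (rad a b c : ℝ) := Real.log_nonneg (by have := four_le_rad h hab hc3; linarith)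
  have hsub : (c * b).primeFactors ⊆ (a * b * c).primeFactors := by
    rw [Nat.primeFactors_mul hc0 hb0, Nat.primeFactors_mul (mul_ne_zero ha0 hb0) hc0,
      Nat.primeFactors_mul ha0 hb0]
    intro q hq
    rcases Finset.mem_union.mp hq with hq | hq
    · exact Finset.mem_union_right _ hq
    · exact Finset.mem_union_left _ (Finset.mem_union_right _ hq)
  have hsuba : a.primeFactors ⊆ (a * b * c).primeFactors := by
    rw [Nat.primeFactors_mul (mul_ne_zero ha0 hb0) hc0, Nat.primeFactors_mul ha0 hb0]
    exact (Finset.subset_union_left).trans Finset.subset_union_left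
  have hprime : ∀ q ∈ (c * b).primeFactors, q.Prime := fun q hq => Nat.prime_of_mem_primeFactors hq
  have hecb : ∀ q ∈ (c * b).primeFactors, (|expDiff c b q| : ℝ) ≤ 6 * Real.log c := by
    intro q hq
    have := abs_expDiff_le hc0 hb0 hbc.symm le_rfl (show b ≤ c by omega) q (Nat.prime_of_mem_primeFactors hq)
    linarith
  have key := log_le_of_kappaSlot hK (by linarith) hσ0 hP (four_le_rad h hab hc3) (by linarith)
    (expDiff c b) ha0 hodd (Nat.Coprime.mul_right hac hcop)
    (prod_le_rad_of_subset hsub) (prod_le_rad_of_subset hsuba) hecb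
    (prod_zpow_expDiff_ne_one hc0 hb0 hbc.symm (by omega))
    (fun p hp => by exact_mod_cast (padicValRat_route_a h hp).symm.le)
  exact slot_reshape hK (by linarith) (Real.rpow_nonneg (by positivity) _) (prod_log_nonneg hprime)
    (prod_log_le_prod_log_max_four hprime) (by positivity) le_rfl le_rfl (by rw [one_mul]; exact key)

/-- **The archimedean slot** (`a² < b`): `log c ≤ 16·(2^{71})^{n'}·n'^{n'}·∏_{q∣cb} log max(4,q)·(log(6log c)·(log G)²)`
(the tree's `log_le_of_archRoute` with Waldschmidt's PROVED Proposition 3.8). [folklore] -/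
theorem slot_arch (h : IsABCTriple a b c) (hab : a ≤ b) (hc3 : 3 ≤ c) (hcase : a ^ 2 < b) :
    Real.log c ≤ 16 * (((2 : ℝ) ^ 71) ^ (c * b).primeFactors.card *
      (((c * b).primeFactors.card : ℝ)) ^ (c * b).primeFactors.card *
      (∏ q ∈ (c * b).primeFactors, Real.log ((max 4 q : ℕ) : ℝ)) *
      (Real.log (6 * Real.log c) * Real.log (rad a b c : ℝ) ^ 2)) := by
  obtain ⟨ha, hb, habc, hcop⟩ := id h
  have hc0 : c ≠ 0 := by omega
  have ha0 : a ≠ 0 := ha.ne'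
  have hb0 : b ≠ 0 := hb.ne'
  have hG4 := four_le_rad h hab hc3
  have hG0 : (0 : ℝ) < rad a b c := by linarith
  have hLG1 : 1 ≤ Real.log (rad a b c : ℝ) := by
    rw [← Real.log_exp 1]; apply Real.log_le_log (Real.exp_pos 1); have := Real.exp_one_lt_d9; linarith
  have h2LG : Real.log (2 * Real.log (rad a b c : ℝ)) ≤ Real.log (rad a b c : ℝ) := by
    have h1 : Real.log (rad a b c : ℝ) ≤ (rad a b c : ℝ) / 2 := by
      have h := Real.log_le_sub_one_of_pos (show (0 : ℝ) < (rad a b c : ℝ) / 2 by linarith)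
      rw [Real.log_div hG0.ne' two_ne_zero] at h
      have := Real.log_two_lt_d9
      linarith
    exact Real.log_le_log (by linarith) (by linarith)
  have hsub : (c * b).primeFactors ⊆ (a * b * c).primeFactors := by
    rw [Nat.primeFactors_mul hc0 hb0, Nat.primeFactors_mul (mul_ne_zero ha0 hb0) hc0,
      Nat.primeFactors_mul ha0 hb0]
    intro q hq
    rcases Finset.mem_union.mp hq with hq | hq
    · exact Finset.mem_union_right _ hq
    · exact Finset.mem_union_left _ (Finset.mem_union_right _ hq)
  have hlog4G : ∀ q ∈ (c * b).primeFactors, Real.log ((max 4 q : ℕ) : ℝ) ≤ Real.log (rad a b c : ℝ) := by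
    intro q hq
    apply Real.log_le_log (by exact_mod_cast lt_of_lt_of_le (by norm_num) (le_max_left 4 q))
    have : ((max 4 q : ℕ) : ℝ) = max (4 : ℝ) (q : ℝ) := by push_cast; rfl
    rw [this]
    refine max_le hG4 ?_
    have := prod_le_rad_of_subset (Finset.singleton_subset_iff.mpr (hsub hq))
    rwa [Finset.prod_singleton] at this
  have hncb1 : 1 ≤ (c * b).primeFactors.card :=
    Finset.card_pos.mpr ((Nat.nonempty_primeFactors.mpr (show 2 ≤ c by omega)).mono
      (by rw [Nat.primeFactors_mul hc0 hb0]; exact Finset.subset_union_left))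
  have hc₆C : 2 * |(2 : ℝ) ^ 70| ≤ (2 : ℝ) ^ 71 := by rw [abs_of_pos (by positivity)]; norm_num
  have hCr1 : (1 : ℝ) ≤ 2 ^ 71 * ((c * b).primeFactors.card : ℝ) := by
    have : (1 : ℝ) ≤ (c * b).primeFactors.card := by exact_mod_cast hncb1
    nlinarith
  have key := log_le_of_archRoute w80Cw (2 ^ 70) w80Cw_nonneg (fun n => w80Cw_le n) waldschmidt1980_hW₂
    hc₆C hCr1 hLG1 h2LG h hab hc3 hcase le_rfl hlog4G
  rw [mul_pow] at key
  convert key using 2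

end Slots

/-! ### Absorptions and shared book-keeping -/

/-- Chebyshev absorption with the top prime of a member `w` whose primes lie in `T₀ ⊆ S`. [folklore] -/
theorem absorb_top {S T₀ : Finset ℕ} {LG : ℝ} (hSprime : ∀ q ∈ S, q.Prime)
    (hlog4 : ∀ q ∈ S, Real.log ((max 4 q : ℕ) : ℝ) ≤ LG) (hLG1 : 1 ≤ LG) (w : ℕ)
    (hSwT : w.primeFactors ⊆ T₀) (hT₀S : T₀ ⊆ S) :
    (T₀.card : ℝ) ^ T₀.card * (largestPrimeFactor w : ℝ) * ∏ q ∈ T₀, Real.log ((max 4 q : ℕ) : ℝ) ≤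
      600 ^ (T₀.card + 1) * (∏ q ∈ T₀, (q : ℝ)) * LG ^ 3 := by
  have hT₀prime : ∀ q ∈ T₀, q.Prime := fun q hq => hSprime q (hT₀S hq)
  have h1 := pow_card_mul_prod_top_mul_prod_log_le hT₀prime
    (T := w.primeFactors.filter (fun q => q = largestPrimeFactor w)) ((Finset.filter_subset _ _).trans hSwT)
    ((card_filter_eq_largestPrimeFactor_le w).trans (by norm_num)) hLG1 (fun q hq => hlog4 q (hT₀S hq))
  rwa [prod_filter_eq_largestPrimeFactor] at h1

/-- Chebyshev absorption without a top prime. [folklore] -/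
theorem absorb_none {S T₀ : Finset ℕ} {LG : ℝ} (hSprime : ∀ q ∈ S, q.Prime)
    (hlog4 : ∀ q ∈ S, Real.log ((max 4 q : ℕ) : ℝ) ≤ LG) (hLG1 : 1 ≤ LG) (hT₀S : T₀ ⊆ S) :
    (T₀.card : ℝ) ^ T₀.card * ∏ q ∈ T₀, Real.log ((max 4 q : ℕ) : ℝ) ≤
      600 ^ (T₀.card + 1) * (∏ q ∈ T₀, (q : ℝ)) * LG ^ 3 := by
  have hT₀prime : ∀ q ∈ T₀, q.Prime := fun q hq => hSprime q (hT₀S hq)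
  have h1 := pow_card_mul_prod_top_mul_prod_log_le hT₀prime (T := ∅) (Finset.empty_subset _)
    (by rw [Finset.card_empty]; norm_num) hLG1 (fun q hq => hlog4 q (hT₀S hq))
  rw [Finset.prod_empty, mul_one] at h1
  exact h1

/-- `n^n ≤ W` and `n₁^{n₁} n₂^{n₂} ≤ W²` from `r^r ≤ W`, `nᵢ ≤ r`, `n₁ + n₂ ≤ 2r`. [folklore] -/
theorem pow_self_le_of_le {n r : ℕ} {W : ℝ} (hrr : ((r : ℝ)) ^ r ≤ W) (hr1 : 1 ≤ r) (hn : n ≤ r) :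
    ((n : ℝ)) ^ n ≤ W := by
  have hr1R : (1 : ℝ) ≤ r := by exact_mod_cast hr1
  calc ((n : ℝ)) ^ n ≤ (r : ℝ) ^ n := pow_le_pow_left₀ (Nat.cast_nonneg _) (by exact_mod_cast hn) n
    _ ≤ (r : ℝ) ^ r := pow_le_pow_right₀ hr1R hn
    _ ≤ W := hrr

/-- See `pow_self_le_of_le`. [folklore] -/
theorem pow_self_mul_le_sq {n₁ n₂ r : ℕ} {W : ℝ} (hrr : ((r : ℝ)) ^ r ≤ W) (hr1 : 1 ≤ r)
    (h1 : n₁ ≤ r) (h2 : n₂ ≤ r) (h12 : n₁ + n₂ ≤ 2 * r) :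
    ((n₁ : ℝ)) ^ n₁ * ((n₂ : ℝ)) ^ n₂ ≤ W ^ 2 := by
  have hr1R : (1 : ℝ) ≤ r := by exact_mod_cast hr1
  calc ((n₁ : ℝ)) ^ n₁ * ((n₂ : ℝ)) ^ n₂ ≤ (r : ℝ) ^ n₁ * (r : ℝ) ^ n₂ :=
        mul_le_mul (pow_le_pow_left₀ (Nat.cast_nonneg _) (by exact_mod_cast h1) n₁)
          (pow_le_pow_left₀ (Nat.cast_nonneg _) (by exact_mod_cast h2) n₂)
          (pow_nonneg (Nat.cast_nonneg _) _) (pow_nonneg (Nat.cast_nonneg _) _)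
    _ = (r : ℝ) ^ (n₁ + n₂) := (pow_add _ _ _).symm
    _ ≤ (r : ℝ) ^ (2 * r) := pow_le_pow_right₀ hr1R h12
    _ = ((r : ℝ) ^ r) ^ 2 := by rw [← pow_mul, mul_comm]
    _ ≤ W ^ 2 := pow_le_pow_left₀ (pow_nonneg (Nat.cast_nonneg _) _) hrr 2

/-- **The final shape**: monotone book-keeping of the constants. [folklore] -/
theorem final_shape {K A M M₀ G Wκ LG Lc Yx u : ℝ} {r τ τ₁ : ℕ}
    (hA : A ≤ 128 * max 1 K ^ 2) (hM1 : 1 ≤ M) (hM : M ≤ M₀) (hYx0 : 0 ≤ Yx)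
    (hYx : Yx ≤ 4 * (LG ^ (2 * τ₁ + 3) * Lc ^ (2 * τ + 1))) (hWκ : 0 ≤ Wκ)
    (hmain : u ^ 2 ≤ A * (600 * M) ^ (2 * r) * 600 ^ 2 * G ^ 2 * Wκ * LG ^ 6 * Yx) :
    u ^ 2 ≤ 512 * max 1 K ^ 2 * (600 * M₀) ^ (2 * r) * 600 ^ 2 * G ^ 2 * Wκ *
      LG ^ (2 * τ₁ + 9) * Lc ^ (2 * τ + 1) := by
  have hM₀0 : 0 < M₀ := by linarith
  have hM' : (600 * M) ^ (2 * r) ≤ (600 * M₀) ^ (2 * r) :=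
    pow_le_pow_left₀ (by linarith) (by linarith) _
  have e : 512 * max 1 K ^ 2 * (600 * M₀) ^ (2 * r) * 600 ^ 2 * G ^ 2 * Wκ *
      LG ^ (2 * τ₁ + 9) * Lc ^ (2 * τ + 1) =
      (128 * max 1 K ^ 2) * (600 * M₀) ^ (2 * r) * 600 ^ 2 * G ^ 2 * Wκ * LG ^ 6 *
        (4 * (LG ^ (2 * τ₁ + 3) * Lc ^ (2 * τ + 1))) := by ring
  rw [e]
  refine hmain.trans ?_
  have h0 : 0 ≤ (128 * max 1 K ^ 2) * (600 * M₀) ^ (2 * r) * 600 ^ 2 * G ^ 2 * Wκ * LG ^ 6 := by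
    positivity
  refine mul_le_mul ?_ hYx hYx0 h0
  exact mul_le_mul_of_nonneg_right (mul_le_mul_of_nonneg_right (mul_le_mul_of_nonneg_right
    (mul_le_mul_of_nonneg_right (mul_le_mul hA hM' (by positivity) (by positivity)) (by positivity))
    (by positivity)) hWκ) (by positivity)

end KappaDoor

end Summit.ABC.StewartYu

end
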